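/-
Copyright (c) 2026 the pub-hodgecm-mathlib formalisation cell (harness21).  Prover seat hodgecm-mathlib-LH4-p04 (g7), req620 Track A «(D-RAM) FOUR-FRAME» squad
(STAGE-1b; dealer∕pen LH4-plan (g13) WORD #71 (2) «(C2-T₊-Δ‴) the type-(2) derived identity for f_{T₊}» = the producer of LH4-p14 (g6)'s (V10) letter (hΔ); C2 lineage ★ p859496 ∕
★ p859511 ∕ ★ p859549), 2026-09-04.
-/
import Summits.HodgeConjecture.HodgeConjecture.Theorems.F0P3cDyRamLevelsTypeTwoDictionary      -- ★ p859496 (this seat): §1 generic profile dictionary at a regular literal, §2 levels, §3 the two norm matches; brings ★ p856218 ∕ ★ p847309 ∕ ★ p846839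
import Summits.HodgeConjecture.HodgeConjecture.Theorems.F0P3cDyRamTransvPlusLawOfCleanLevels    -- ★ p859751 (LH4-p05 (g8)): `two_mul_transvPlusFixCount_eq_clean`, `shellFixCount_eq_sub` (pure lattice algebra at any literal); brings ★ №5∕№6 tokens
import Literature.NumberTheory.Automorphic.UnitaryThreeFourFrameFixedCosetDictionary               -- ★ `exists_equiv_fixedBy_quotient_orbit` (fixed cosets ≃ fixed orbit vertices)
import Summits.HodgeConjecture.HodgeConjecture.Theorems.F0P3cDyRamDOfPlaceOfDatum                  -- ★ `dOfPlace_eq_of_isRamifiedQuadraticDatum`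
import HarnessLib

/-!
# Crux `H413`, line LH4 «(D-RAM) FOUR-FRAME» — STAGE-1b, row (2): brick (C2-T₊-Δ‴) «THE TYPE-(2) DERIVED IDENTITY FOR f_{T₊}»
# `Σᶠ_c Δ‴·Φ(c, f_{T₊}) = ½·Σᶠ_c Δ‴·Φ(c, 𝟙_{K_{ℓ₀,m_c}}) − ½·Σᶠ_c Δ‴·Φ(c, 𝟙_{K_{ℓ₀+1,m_c}})` near `1` on the type-(2) population ⟸ (α′)₂ + (β₂)

Cell `hodgecm-mathlib` (D-0151), FLOOR 0, crux item H413 = `stmt-HodgeConjecture-24833`, route of record `HCCMUnconditional`; squad F0∕P3c∕LH4; lane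
`--supports stmt-HodgeConjecture-24833 --as helper` (count-neutral; pays NO tier-0 row).  THEOREMS ONLY (no `def`, no instance, no notation, no `sorry`); every census ∕ label law
enters as a HYPOTHESIS binder — nothing is asserted.  Consumer: LH4-p14 (g6)'s (V10) `rowTwo_transvPlus_of_levels (hΔ) (h₁) (h₂)` (dealer WORD #71 (1)); `h₁ h₂` = ★ p859606's conclusion
at the two clean level instances; THIS FILE produces (hΔ).
THE POINT (the row-(2) twin of ★ p859751 §2, LH4-p05 (g8)).  `f_{T₊} = pieceTransvPlus` is NOT `½(𝟙_{K_{ℓ₀,m_c}} − 𝟙_{K_{ℓ₀+1,m_c}})` as a function; the identity holds for the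
Δ‴-weighted orbital sums near `1`, by CENSUS: (i) one pair of norm matches `δ₊, δ₋` (κ = ±1) serves all three sums, `Σᶠ_c Δ‴·Φ(c, g) = τ·D·(Φ(δ₊, g) − Φ(δ₋, g))` for every `g`
(★ p847309 road, ★ p859496 §3); (ii) at the regular literals `ι_w δ_±` (compact centraliser ★ p846839) each orbital integral is `νG₃(K)·count` — levels ★ p859496 §2, `f_{T₊}` §1 here
(`transvPlusFixCount`); (iii) the fixed type-0 set of `ι_w δ` is FINITE (§1, transported from the finite fixed cosets ★ `finite_fixedBy_quotient_of_isClosed`); (iv) per literal, GIVEN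
(α′) «label + on the shell ⇒ X²M ⊆ ϖ^{m_c}M» and `m* ≤ m_c`: `2·T₊(T) = lev(ℓ₀, m_c)(T) − lev(ℓ₀+1, m_c)(T) + (T₊ − T−′)(T)` (★ p859751 `two_mul_transvPlusFixCount_eq_clean` +
`shellFixCount_eq_sub`; §2); (v) (β₂) «`T₊ − T−′` takes the same value at ι_w δ₊ and ι_w δ₋» kills the last term IN THE DIFFERENCE — exactly as (β) kills frame-constants in κ-signed
sums on row (1) — whence the `½`.  LETTERS (hypothesis binders; population = norm matches of G-regular non-split γ_H near 1, NOT K-wide): (α′)₂ = ★ №6 `LabelPlusCleanLawAt`'s body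
with the type-(1) literal `Γ b` replaced by `ι_w δ`; (β₂) = ★ №6 `CleanSgnFrameConstLawAt`'s «`T₊ − T−′` constant» over the two-literal family (the data — F0P3-p01 (g35) 10:13Z,
`f_sgn′ ≡ 0` frame by frame on every near-1 type-(2a) key — support the stronger per-literal `T₊ = T−′`, which implies it).
HONEST LABEL.  Count-neutral; (α′)₂ and (β₂) are HYPOTHESES (prover targets of the label lane), nothing printed is asserted; `HC_CM` is proved only modulo the 7 printed citations
(2 remaining named inputs: hLiu418 = `stmt-HodgeConjecture-24832`, h413 = `stmt-HodgeConjecture-24833`) until rung 0 closes.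
## References
* [Kottwitz1988] R. E. Kottwitz, *Tamagawa numbers*, Ann. of Math. 127 (1988): §2.  [Kottwitz1986BaseChangeUnits] R. E. Kottwitz, Compositio Math. 60 (1986): §1 pp. 240–241.
* [Rogawski1990] J. D. Rogawski, *Automorphic Representations of Unitary Groups in Three Variables*, Ann. of Math. Stud. 123 (1990): §4.3 (4.3.1)–(4.3.2) p. 43; §4.9 Prop. 4.9.1 (a)(b) p. 55.
* [Laumon1995] G. Laumon, *Cohomology of Drinfeld Modular Varieties I* (1996): Lemma (5.3.2) p. 136.  [LanglandsShelstad1987] R. P. Langlands, D. Shelstad, Math. Ann. 278 (1987): §1.3.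
-/

set_option autoImplicit false

noncomputable section
namespace Summit.HodgeConjecture.HodgeConjecture.Cruxes.H413.F0P3cDyRamTransvPlusTypeTwoOfCleanLevels

open MeasureTheory Measure NumberField IsDedekindDomain Topology Filter
open Literature.NumberTheory.Automorphic Literature.NumberTheory.Automorphic.UnitaryGroup Literature.NumberTheory.Automorphic.IntegralReduction
open Literature.NumberTheory.Automorphic.UnitaryLatticeTree Literature.NumberTheory.Automorphic.HermitianLattice
open Literature.NumberTheory.Rogawski1990 Literature.NumberTheory.GaloisRepresentations
open Literature.NumberTheory.Automorphic.UnitaryThreeFourFrame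
open Summit.HodgeConjecture.HodgeConjecture.Cruxes.H413.F0P3cDyRamFourFramePieces
open Summit.HodgeConjecture.HodgeConjecture.Cruxes.H413.F0P3cDyRamFourFrameCensusDefs
open Summit.HodgeConjecture.HodgeConjecture.Cruxes.H413.F0P3cDyRamProfileLabelTransport
open Summit.HodgeConjecture.HodgeConjecture.Cruxes.H413.F0P3cDyRamProfilePiecesProps
open Summit.HodgeConjecture.HodgeConjecture.Cruxes.H413.F0P3cDyRamLevelsPieceCountDictionary
open Summit.HodgeConjecture.HodgeConjecture.Cruxes.H413.F0P3cDyRamLevelsTypeTwoDictionary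
open Summit.HodgeConjecture.HodgeConjecture.Cruxes.H413.F0P3cDyRamFourFrameHSideDefs
open Summit.HodgeConjecture.HodgeConjecture.Cruxes.H413.F0P3cDyRamStageOneBDefs
open Summit.HodgeConjecture.HodgeConjecture.Cruxes.H413.F0P3cDyRamTransvPlusLawOfCleanLevels
open Summit.HodgeConjecture.HodgeConjecture.Cruxes.H413.F0P3cDyRamDOfPlaceOfDatum
open scoped Valued WithZero Matrix MatrixGroups Classical

/-! ## §1 The piece `f_{T₊}` at any regular literal with compact centraliser: dictionary and finiteness -/

/-- **THE (D-G) DICTIONARY OF `f_{T₊} = pieceTransvPlus` AT ANY REGULAR LITERAL WITH COMPACT CENTRALISER** (so at the type-(2) norm matches):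
`Φ(⟦γ⟧, f_{T₊}; mG₃) = νG₃(K).toReal · transvPlusFixCount σ_w ϖ d₀ (d₀ % 2) m*₀ (ι_w γ)` (`d₀ = dOfPlace`, `m*₀ = mstarFn`; ★ census DEFS `cntTransvPlus`'s token) — ★ p859496 §1 at the
labelled near-transvection profile with ★ `isLocSmooth_pieceTransvPlus` ∕ `pieces_conj_eq` ∕ `transvPlus_profile_conj_iff` (the clauses of ★ `pieceCountDictionary_transvPlus`).
[cite: Kottwitz1988, §2] [cite: Kottwitz1986BaseChangeUnits, §1 pp. 240–241] [cite: Rogawski1990, §4.9 Prop. 4.9.1 (b) p. 55] -/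
theorem classOrbitalIntegral_transvPlus_eq_mul_ncard_of_isRegularElt (L : Type) [Field L] [NumberField L] [IsCMField L]
    {v : HeightOneSpectrum (𝓞 ↥(maximalRealSubfield L))} (w : UnitaryGroup.PlacesOver L v)
    (hw : IsCMField.complexConj L • w.1 = w.1) (he : v.asIdeal.ramificationIdx' w.1.asIdeal ≠ 1)
    (ϖ : (w.1.adicCompletion L)) (hϖ : Valued.v ϖ = WithZero.exp (-1 : ℤ))
    [MeasurableSpace ((UnitaryGroup.cmDatum L 3 (Matrix.of fun i j : Fin 3 => if i.val + j.val + 1 = 3 then (1 : L) else 0)).Local v)] [BorelSpace ((UnitaryGroup.cmDatum L 3 (Matrix.of fun i j : Fin 3 => if i.val + j.val + 1 = 3 then (1 : L) else 0)).Local v)]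
    [∀ γ : ((UnitaryGroup.cmDatum L 3 (Matrix.of fun i j : Fin 3 => if i.val + j.val + 1 = 3 then (1 : L) else 0)).Local v), MeasurableSpace (((UnitaryGroup.cmDatum L 3 (Matrix.of fun i j : Fin 3 => if i.val + j.val + 1 = 3 then (1 : L) else 0)).Local v) ⧸ Subgroup.centralizer ({γ} : Set ((UnitaryGroup.cmDatum L 3 (Matrix.of fun i j : Fin 3 => if i.val + j.val + 1 = 3 then (1 : L) else 0)).Local v)))]
    [∀ γ : ((UnitaryGroup.cmDatum L 3 (Matrix.of fun i j : Fin 3 => if i.val + j.val + 1 = 3 then (1 : L) else 0)).Local v), BorelSpace (((UnitaryGroup.cmDatum L 3 (Matrix.of fun i j : Fin 3 => if i.val + j.val + 1 = 3 then (1 : L) else 0)).Local v) ⧸ Subgroup.centralizer ({γ} : Set ((UnitaryGroup.cmDatum L 3 (Matrix.of fun i j : Fin 3 => if i.val + j.val + 1 = 3 then (1 : L) else 0)).Local v)))]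
    (νG₃ : Measure ((UnitaryGroup.cmDatum L 3 (Matrix.of fun i j : Fin 3 => if i.val + j.val + 1 = 3 then (1 : L) else 0)).Local v)) [νG₃.IsHaarMeasure] [νG₃.IsMulRightInvariant]
    (mG₃ : OrbitalMeasureFamily ((UnitaryGroup.cmDatum L 3 (Matrix.of fun i j : Fin 3 => if i.val + j.val + 1 = 3 then (1 : L) else 0)).Local v))
    (hcan : mG₃.IsCanonical (fun γ => IsRegularElt (γ.val : GL (Fin 3) (UnitaryGroup.LocalRing L v))) νG₃)
    (γ : ((UnitaryGroup.cmDatum L 3 (Matrix.of fun i j : Fin 3 => if i.val + j.val + 1 = 3 then (1 : L) else 0)).Local v))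
    (hreg : IsRegularElt (γ.val : GL (Fin 3) (UnitaryGroup.LocalRing L v)))
    [CompactSpace (Subgroup.centralizer ({γ} : Set ((UnitaryGroup.cmDatum L 3 (Matrix.of fun i j : Fin 3 => if i.val + j.val + 1 = 3 then (1 : L) else 0)).Local v)))] :
    classOrbitalIntegral mG₃ (pieceTransvPlus L v w hw ϖ) (ConjClasses.mk γ) =
      ((νG₃ ((cmLocalIntegralLevel L 3 (Matrix.of fun i j : Fin 3 => if i.val + j.val + 1 = 3 then (1 : L) else 0) v) : Set ((UnitaryGroup.cmDatum L 3 (Matrix.of fun i j : Fin 3 => if i.val + j.val + 1 = 3 then (1 : L) else 0)).Local v))).toReal : ℂ) *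
        (transvPlusFixCount (galAdicCompletionMap (L := L) (IsCMField.complexConj L) hw) ϖ (dOfPlace L v w) (dOfPlace L v w % 2) (mstarFn L v w)
          ((localNonsplitEquiv (IsCMField.complexConj L) (Matrix.of fun i j : Fin 3 => if i.val + j.val + 1 = 3 then (1 : L) else 0) (IsCMField.complexConj_ne_one L) w hw γ :
                ↥(unitaryGroupOfForm (galAdicCompletionMap (L := L) (IsCMField.complexConj L) hw) (placeForm (Matrix.of fun i j : Fin 3 => if i.val + j.val + 1 = 3 then (1 : L) else 0) w.1))) : GL (Fin 3) (w.1.adicCompletion L)) : ℂ) := by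
  have hϖ0 : ϖ ≠ 0 := (uniformizer_facts L w hϖ).1
  exact classOrbitalIntegral_profile_eq_mul_ncard_of_isRegularElt L w hw he ϖ hϖ νG₃ mG₃ hcan
    (fun X => NearTransvShell ϖ (dOfPlace L v w % 2) (mstarFn L v w) X ∧ LabelPlus (galAdicCompletionMap (L := L) (IsCMField.complexConj L) hw) ϖ (dOfPlace L v w) (mstarFn L v w) X)
    (fun X M => LatticeNearTransvShell ϖ (dOfPlace L v w % 2) (mstarFn L v w) X M ∧ LatticeLabelPlus (galAdicCompletionMap (L := L) (IsCMField.complexConj L) hw) ϖ (dOfPlace L v w) (mstarFn L v w) M X)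
    _ rfl (isLocSmooth_pieceTransvPlus L w hw hϖ) (fun k hk x => (pieces_conj_eq L w hw hϖ hk x).1)
    (fun T x hx => transvPlus_profile_conj_iff (galAdicCompletionMap (L := L) (IsCMField.complexConj L) hw) hϖ0 (dOfPlace L v w) (dOfPlace L v w % 2) (mstarFn L v w) T hx) γ hreg

/-- **THE FIXED TYPE-0 VERTICES OF A REGULAR LITERAL WITH COMPACT CENTRALISER ARE FINITE**: `{M ∣ type-0 vertex, ι_w γ·M = M}` is finite — the fixed cosets `Fix_γ(G ⧸ K)` are finite
(★ `finite_fixedBy_quotient_of_isClosed`: closed class of a regular element, `K` compact open) and biject onto the fixed type-0 vertices (★ `exists_equiv_fixedBy_quotient_orbit`, `K = Stab 𝒪³`,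
`U(Φ₃)` transitive on type-0 vertices ★ `exists_unitary_mapGL_eq_of_isSelfDualLattice_ramifiedCM`). [cite: Kottwitz1988, §2] [cite: Laumon1995, Lemma (5.3.2) p. 136] -/
theorem finite_fixed_typeZero_of_isRegularElt (L : Type) [Field L] [NumberField L] [IsCMField L]
    {v : HeightOneSpectrum (𝓞 ↥(maximalRealSubfield L))} (w : UnitaryGroup.PlacesOver L v)
    (hw : IsCMField.complexConj L • w.1 = w.1) (he : v.asIdeal.ramificationIdx' w.1.asIdeal ≠ 1)
    (ϖ : (w.1.adicCompletion L)) (hϖ : Valued.v ϖ = WithZero.exp (-1 : ℤ))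
    (γ : ((UnitaryGroup.cmDatum L 3 (Matrix.of fun i j : Fin 3 => if i.val + j.val + 1 = 3 then (1 : L) else 0)).Local v))
    (hreg : IsRegularElt (γ.val : GL (Fin 3) (UnitaryGroup.LocalRing L v)))
    [CompactSpace (Subgroup.centralizer ({γ} : Set ((UnitaryGroup.cmDatum L 3 (Matrix.of fun i j : Fin 3 => if i.val + j.val + 1 = 3 then (1 : L) else 0)).Local v)))] :
    {M : Submodule (Valued.integer (w.1.adicCompletion L)) (Fin 3 → w.1.adicCompletion L) |
        IsVertexLattice (galAdicCompletionMap (L := L) (IsCMField.complexConj L) hw) ϖ ((StdForm.antidiagonal 3).over (w.1.adicCompletion L)) 0 M ∧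
          mapGL ((localNonsplitEquiv (IsCMField.complexConj L) (Matrix.of fun i j : Fin 3 => if i.val + j.val + 1 = 3 then (1 : L) else 0) (IsCMField.complexConj_ne_one L) w hw γ :
                ↥(unitaryGroupOfForm (galAdicCompletionMap (L := L) (IsCMField.complexConj L) hw) (placeForm (Matrix.of fun i j : Fin 3 => if i.val + j.val + 1 = 3 then (1 : L) else 0) w.1))) : GL (Fin 3) (w.1.adicCompletion L)) M = M}.Finite := by
  have hc1 : IsCMField.complexConj L ≠ 1 := IsCMField.complexConj_ne_one L
  have hpf : placeForm (Matrix.of fun i j : Fin 3 => if i.val + j.val + 1 = 3 then (1 : L) else 0) w.1 = (StdForm.antidiagonal 3).over (w.1.adicCompletion L) := placeForm_antidiagThree_eq_over L w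
  have hH : (((Matrix.of fun i j : Fin 3 => if i.val + j.val + 1 = 3 then (1 : L) else 0)).map (cmConjRingHom L))ᵀ = (Matrix.of fun i j : Fin 3 => if i.val + j.val + 1 = 3 then (1 : L) else 0) := antidiagOne_isHermitian L 3
  have hdet : ((Matrix.of fun i j : Fin 3 => if i.val + j.val + 1 = 3 then (1 : L) else 0)).det ≠ 0 := (isUnit_antidiagOne_det L 3).ne_zero
  obtain ⟨hKc, hKo⟩ := isCompact_isOpen_cmLocalIntegralLevel L 3 (Matrix.of fun i j : Fin 3 => if i.val + j.val + 1 = 3 then (1 : L) else 0) v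
  have hO := isClosed_conjClass_local_of_isRegularElt L 3 (Matrix.of fun i j : Fin 3 => if i.val + j.val + 1 = 3 then (1 : L) else 0) v hH hdet γ hreg
  have hfin : (MulAction.fixedBy (((UnitaryGroup.cmDatum L 3 (Matrix.of fun i j : Fin 3 => if i.val + j.val + 1 = 3 then (1 : L) else 0)).Local v) ⧸ (cmLocalIntegralLevel L 3 (Matrix.of fun i j : Fin 3 => if i.val + j.val + 1 = 3 then (1 : L) else 0) v)) γ).Finite := finite_fixedBy_quotient_of_isClosed γ (cmLocalIntegralLevel L 3 (Matrix.of fun i j : Fin 3 => if i.val + j.val + 1 = 3 then (1 : L) else 0) v) hO hKo hKc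
  -- the embedding `ι_w` as a monoid hom and the stabiliser clause `K = Stab 𝒪³`
  let ι : ((UnitaryGroup.cmDatum L 3 (Matrix.of fun i j : Fin 3 => if i.val + j.val + 1 = 3 then (1 : L) else 0)).Local v) →* GL (Fin 3) (w.1.adicCompletion L) :=
    (Subgroup.subtype _).comp (localNonsplitEquiv (IsCMField.complexConj L) (Matrix.of fun i j : Fin 3 => if i.val + j.val + 1 = 3 then (1 : L) else 0) hc1 w hw).toMulEquiv.toMonoidHom
  have hιe : ∀ u, ι u = ((localNonsplitEquiv (IsCMField.complexConj L) (Matrix.of fun i j : Fin 3 => if i.val + j.val + 1 = 3 then (1 : L) else 0) (IsCMField.complexConj_ne_one L) w hw u :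
        ↥(unitaryGroupOfForm (galAdicCompletionMap (L := L) (IsCMField.complexConj L) hw) (placeForm (Matrix.of fun i j : Fin 3 => if i.val + j.val + 1 = 3 then (1 : L) else 0) w.1))) : GL (Fin 3) (w.1.adicCompletion L)) := fun _ => rfl
  have hN : IsVertexLattice (galAdicCompletionMap (L := L) (IsCMField.complexConj L) hw) ϖ ((StdForm.antidiagonal 3).over (w.1.adicCompletion L)) 0 (stdLattice (w.1.adicCompletion L) 3) :=
    isSelfDualLattice_stdLattice_three_of_v hϖ
  have hKt : ∀ u : ((UnitaryGroup.cmDatum L 3 (Matrix.of fun i j : Fin 3 => if i.val + j.val + 1 = 3 then (1 : L) else 0)).Local v), u ∈ (cmLocalIntegralLevel L 3 (Matrix.of fun i j : Fin 3 => if i.val + j.val + 1 = 3 then (1 : L) else 0) v) ↔ mapGL (ι u) (stdLattice (w.1.adicCompletion L) 3) = stdLattice (w.1.adicCompletion L) 3 := fun u => by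
    rw [hιe]
    exact (mem_localIntegralLevel_iff_of_smul_eq (IsCMField.complexConj L) 3 (Matrix.of fun i j : Fin 3 => if i.val + j.val + 1 = 3 then (1 : L) else 0) hc1 w hw u).trans (mapGL_stdLattice_eq_iff_mem_glInt _).symm
  have htr : ∀ M : Submodule 𝒪[w.1.adicCompletion L] (Fin 3 → w.1.adicCompletion L),
      IsVertexLattice (galAdicCompletionMap (L := L) (IsCMField.complexConj L) hw) ϖ ((StdForm.antidiagonal 3).over (w.1.adicCompletion L)) 0 M → ∃ u : ((UnitaryGroup.cmDatum L 3 (Matrix.of fun i j : Fin 3 => if i.val + j.val + 1 = 3 then (1 : L) else 0)).Local v), mapGL (ι u) (stdLattice (w.1.adicCompletion L) 3) = M := by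
    intro M hM
    obtain ⟨u₁, hu₁⟩ := exists_unitary_mapGL_eq_of_isSelfDualLattice_ramifiedCM L v w hw he hϖ hN hM
    have hu₁' : (u₁ : GL (Fin 3) (w.1.adicCompletion L)) ∈ unitaryGroupOfForm (galAdicCompletionMap (L := L) (IsCMField.complexConj L) hw) (placeForm (Matrix.of fun i j : Fin 3 => if i.val + j.val + 1 = 3 then (1 : L) else 0) w.1) := by
      rw [hpf]; exact u₁.2
    refine ⟨(localNonsplitEquiv (IsCMField.complexConj L) (Matrix.of fun i j : Fin 3 => if i.val + j.val + 1 = 3 then (1 : L) else 0) hc1 w hw).symm ⟨(u₁ : GL (Fin 3) (w.1.adicCompletion L)), hu₁'⟩, ?_⟩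
    rw [hιe, ContinuousMulEquiv.apply_symm_apply]
    exact hu₁
  -- the fixed cosets biject onto the fixed orbit vertices; the orbit is the type-0 vertex set
  obtain ⟨e, -⟩ := exists_equiv_fixedBy_quotient_orbit ι (stdLattice (w.1.adicCompletion L) 3) (cmLocalIntegralLevel L 3 (Matrix.of fun i j : Fin 3 => if i.val + j.val + 1 = 3 then (1 : L) else 0) v) hKt γ
  haveI : Finite (MulAction.fixedBy (((UnitaryGroup.cmDatum L 3 (Matrix.of fun i j : Fin 3 => if i.val + j.val + 1 = 3 then (1 : L) else 0)).Local v) ⧸ (cmLocalIntegralLevel L 3 (Matrix.of fun i j : Fin 3 => if i.val + j.val + 1 = 3 then (1 : L) else 0) v)) γ) := hfin.to_subtype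
  have horb : {M : Submodule 𝒪[w.1.adicCompletion L] (Fin 3 → w.1.adicCompletion L) |
      (∃ u : ((UnitaryGroup.cmDatum L 3 (Matrix.of fun i j : Fin 3 => if i.val + j.val + 1 = 3 then (1 : L) else 0)).Local v), mapGL (ι u) (stdLattice (w.1.adicCompletion L) 3) = M) ∧ mapGL (ι γ) M = M}.Finite :=
    Set.finite_coe_iff.1 (Finite.of_equiv _ e)
  refine horb.subset fun M hM => ?_
  exact ⟨htr M hM.1, by rw [hιe]; exact hM.2⟩

/-! ## §2 Per-literal lattice algebra: twice the `+`-count is the clean level difference plus the clean-sign difference -/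

section Lattice

variable {K : Type} [Field K] [Valued K ℤᵐ⁰]

/-- **`2·T₊(T) = lev(ℓ, m_c)(T) − lev(ℓ+1, m_c)(T) + (T₊(T) − T−′(T))` IN `ℤ`** at any literal `T` with a finite fixed type-0 set, GIVEN (α′) at `T` («label `+` on the shell `(ℓ, m)` ⇒
`X²·M ⊆ ϖ^{m_c}M`») and `m ≤ m_c`: ★ p859751 `two_mul_transvPlusFixCount_eq_clean` (the clean shell splits as `T₊ ⊔ T−′`) + `shellFixCount_eq_sub` (clean shell = `lev(ℓ, m_c) − lev(ℓ+1, m_c)`,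
★ p858704 §3 bridge).  Pure lattice algebra; no law. [cite: Rogawski1990, §4.9 Prop. 4.9.1 (a)(b) p. 55] -/
theorem two_mul_transvPlusFixCount_eq_levels_sub_add (σ : K →+* K) {ϖ : K} (hϖ1 : Valued.v ϖ ≤ 1) (d ℓ : ℕ) {m mc : ℕ} (hmc : m ≤ mc) (T : GL (Fin 3) K)
    (hfin : {M : Submodule (Valued.integer K) (Fin 3 → K) | IsVertexLattice σ ϖ ((StdForm.antidiagonal 3).over K) 0 M ∧ mapGL T M = M}.Finite)
    (hα : ∀ M : Submodule (Valued.integer K) (Fin 3 → K), IsVertexLattice σ ϖ ((StdForm.antidiagonal 3).over K) 0 M → mapGL T M = M →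
      LatticeNearTransvShell ϖ ℓ m ((T : Matrix (Fin 3) (Fin 3) K) - 1) M → LatticeLabelPlus σ ϖ d m M ((T : Matrix (Fin 3) (Fin 3) K) - 1) →
      LatticeInLevel ϖ mc (((T : Matrix (Fin 3) (Fin 3) K) - 1) * ((T : Matrix (Fin 3) (Fin 3) K) - 1)) M) :
    2 * (transvPlusFixCount σ ϖ d ℓ m T : ℤ) =
      (levFixCount σ ϖ ℓ mc T : ℤ) - (levFixCount σ ϖ (ℓ + 1) mc T : ℤ) +
        ((transvPlusFixCount σ ϖ d ℓ m T : ℤ) - (cleanMinusFixCount σ ϖ d ℓ m mc T : ℤ)) := by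
  rw [two_mul_transvPlusFixCount_eq_clean σ hϖ1 d ℓ hmc T hfin hα, shellFixCount_eq_sub σ hϖ1 ℓ mc T hfin]

/-- **THE DIFFERENCE OVER TWO LITERALS**: if (α′) holds at `T₁` and `T₂` and the clean-sign count `T₊ − T−′` takes the SAME value at both ((β₂)), then
`2·(T₊(T₁) − T₊(T₂)) = (lev(ℓ, m_c)(T₁) − lev(ℓ, m_c)(T₂)) − (lev(ℓ+1, m_c)(T₁) − lev(ℓ+1, m_c)(T₂))`. [cite: Rogawski1990, §4.9 Prop. 4.9.1 (a)(b) p. 55] [cite: LanglandsShelstad1987, §1.3] -/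
theorem two_mul_sub_transvPlusFixCount_eq_of_cleanSgn_eq (σ : K →+* K) {ϖ : K} (hϖ1 : Valued.v ϖ ≤ 1) (d ℓ : ℕ) {m mc : ℕ} (hmc : m ≤ mc) (T₁ T₂ : GL (Fin 3) K)
    (hfin₁ : {M : Submodule (Valued.integer K) (Fin 3 → K) | IsVertexLattice σ ϖ ((StdForm.antidiagonal 3).over K) 0 M ∧ mapGL T₁ M = M}.Finite)
    (hfin₂ : {M : Submodule (Valued.integer K) (Fin 3 → K) | IsVertexLattice σ ϖ ((StdForm.antidiagonal 3).over K) 0 M ∧ mapGL T₂ M = M}.Finite)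
    (hα₁ : ∀ M : Submodule (Valued.integer K) (Fin 3 → K), IsVertexLattice σ ϖ ((StdForm.antidiagonal 3).over K) 0 M → mapGL T₁ M = M →
      LatticeNearTransvShell ϖ ℓ m ((T₁ : Matrix (Fin 3) (Fin 3) K) - 1) M → LatticeLabelPlus σ ϖ d m M ((T₁ : Matrix (Fin 3) (Fin 3) K) - 1) →
      LatticeInLevel ϖ mc (((T₁ : Matrix (Fin 3) (Fin 3) K) - 1) * ((T₁ : Matrix (Fin 3) (Fin 3) K) - 1)) M)
    (hα₂ : ∀ M : Submodule (Valued.integer K) (Fin 3 → K), IsVertexLattice σ ϖ ((StdForm.antidiagonal 3).over K) 0 M → mapGL T₂ M = M →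
      LatticeNearTransvShell ϖ ℓ m ((T₂ : Matrix (Fin 3) (Fin 3) K) - 1) M → LatticeLabelPlus σ ϖ d m M ((T₂ : Matrix (Fin 3) (Fin 3) K) - 1) →
      LatticeInLevel ϖ mc (((T₂ : Matrix (Fin 3) (Fin 3) K) - 1) * ((T₂ : Matrix (Fin 3) (Fin 3) K) - 1)) M)
    (hβ : (transvPlusFixCount σ ϖ d ℓ m T₁ : ℤ) - (cleanMinusFixCount σ ϖ d ℓ m mc T₁ : ℤ) =
      (transvPlusFixCount σ ϖ d ℓ m T₂ : ℤ) - (cleanMinusFixCount σ ϖ d ℓ m mc T₂ : ℤ)) :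
    2 * ((transvPlusFixCount σ ϖ d ℓ m T₁ : ℤ) - (transvPlusFixCount σ ϖ d ℓ m T₂ : ℤ)) =
      ((levFixCount σ ϖ ℓ mc T₁ : ℤ) - (levFixCount σ ϖ ℓ mc T₂ : ℤ)) - ((levFixCount σ ϖ (ℓ + 1) mc T₁ : ℤ) - (levFixCount σ ϖ (ℓ + 1) mc T₂ : ℤ)) := by
  have h₁ := two_mul_transvPlusFixCount_eq_levels_sub_add σ hϖ1 d ℓ hmc T₁ hfin₁ hα₁
  have h₂ := two_mul_transvPlusFixCount_eq_levels_sub_add σ hϖ1 d ℓ hmc T₂ hfin₂ hα₂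
  linear_combination h₁ - h₂ + hβ

end Lattice

/-! ## §3 HEAD — (hΔ): the type-(2) derived identity for `f_{T₊}` from (α′)₂ and (β₂) -/

set_option maxHeartbeats 400000 in
/-- **(C2-T₊-Δ‴) THE TYPE-(2) DERIVED IDENTITY FOR `f_{T₊}`** — LH4-p14 (g6)'s letter (hΔ) v1 (`hDelta.letter.v1` f2316d92, its `∃ V …` body VERBATIM), PRODUCED per place from two
HYPOTHESIS letters on the type-(2) population near `1` (norm matches `δ` of `G`-regular `γ_H` without a `w`-split root): **(α′)₂** `hαT` — every fixed type-0 vertex of `ι_w δ` on the shell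
`(ℓ₀, m*)` with label `+` has `X²·M ⊆ ϖ^{m_c}M` (★ №6 `LabelPlusCleanLawAt`'s body at the literal `ι_w δ`); **(β₂)** `hβT` — the clean-sign count `T₊ − T−′` takes the same value at the
`κ = +1` and the `κ = −1` match.  Then `Σᶠ_c Δ‴·Φ(c, f_{T₊}) = ½·Σᶠ_c Δ‴·Φ(c, 𝟙_{K_{ℓ₀,m_c}}) − ½·Σᶠ_c Δ‴·Φ(c, 𝟙_{K_{ℓ₀+1,m_c}})` near `1`.  Proof: one norm-match pair for all three sums
(★ p847309 road), the dictionaries §1 ∕ ★ p859496 §2 at `δ_±`, finiteness §1, the lattice identity §2, `dOfPlace = d` (★), `m* ≤ m_c`; laws are hypotheses, nothing asserted.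
[cite: Rogawski1990, §4.3 (4.3.1)–(4.3.2) p. 43; §4.9 Prop. 4.9.1 (a)(b) p. 55] [cite: Kottwitz1988, §2] [cite: LanglandsShelstad1987, §1.3] -/
theorem finsum_delta_transvPlus_eq_half_levels_of_labelClean_of_cleanSgn (L : Type) [Field L] [NumberField L] [IsCMField L]
    {v : HeightOneSpectrum (𝓞 ↥(maximalRealSubfield L))} (w : UnitaryGroup.PlacesOver L v)
    (hw : IsCMField.complexConj L • w.1 = w.1) (he : v.asIdeal.ramificationIdx' w.1.asIdeal ≠ 1)
    (ϖ : (w.1.adicCompletion L)) (hϖ : Valued.v ϖ = WithZero.exp (-1 : ℤ)) (d tE : ℕ)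
    (hD : IsRamifiedQuadraticDatum (galAdicCompletionMap (L := L) (IsCMField.complexConj L) hw) ϖ d tE) (μ : HeckeCharacter L)
    [MeasurableSpace ((UnitaryGroup.cmDatum L 3 (Matrix.of fun i j : Fin 3 => if i.val + j.val + 1 = 3 then (1 : L) else 0)).Local v)] [BorelSpace ((UnitaryGroup.cmDatum L 3 (Matrix.of fun i j : Fin 3 => if i.val + j.val + 1 = 3 then (1 : L) else 0)).Local v)]
    [∀ γ : ((UnitaryGroup.cmDatum L 3 (Matrix.of fun i j : Fin 3 => if i.val + j.val + 1 = 3 then (1 : L) else 0)).Local v), MeasurableSpace (((UnitaryGroup.cmDatum L 3 (Matrix.of fun i j : Fin 3 => if i.val + j.val + 1 = 3 then (1 : L) else 0)).Local v) ⧸ Subgroup.centralizer ({γ} : Set ((UnitaryGroup.cmDatum L 3 (Matrix.of fun i j : Fin 3 => if i.val + j.val + 1 = 3 then (1 : L) else 0)).Local v)))]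
    [∀ γ : ((UnitaryGroup.cmDatum L 3 (Matrix.of fun i j : Fin 3 => if i.val + j.val + 1 = 3 then (1 : L) else 0)).Local v), BorelSpace (((UnitaryGroup.cmDatum L 3 (Matrix.of fun i j : Fin 3 => if i.val + j.val + 1 = 3 then (1 : L) else 0)).Local v) ⧸ Subgroup.centralizer ({γ} : Set ((UnitaryGroup.cmDatum L 3 (Matrix.of fun i j : Fin 3 => if i.val + j.val + 1 = 3 then (1 : L) else 0)).Local v)))]
    (νG₃ : Measure ((UnitaryGroup.cmDatum L 3 (Matrix.of fun i j : Fin 3 => if i.val + j.val + 1 = 3 then (1 : L) else 0)).Local v)) [νG₃.IsHaarMeasure] [νG₃.IsMulRightInvariant]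
    (mG₃ : OrbitalMeasureFamily ((UnitaryGroup.cmDatum L 3 (Matrix.of fun i j : Fin 3 => if i.val + j.val + 1 = 3 then (1 : L) else 0)).Local v))
    (hmG : mG₃.IsCanonical (fun γ => IsRegularElt (γ.val : GL (Fin 3) (UnitaryGroup.LocalRing L v))) νG₃)
    (hαT : ∃ V ∈ 𝓝 (1 : ((UnitaryGroup.cmDatum L 2 (Matrix.of fun i j : Fin 2 => if i.val + j.val + 1 = 2 then (1 : L) else 0)).Local v × (UnitaryGroup.cmDatum L 1 (Matrix.of fun i j : Fin 1 => if i.val + j.val + 1 = 1 then (1 : L) else 0)).Local v)), ∀ γH ∈ V, IsLocalGRegular L v γH →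
      ¬ (∃ x : (w.1.adicCompletion L), (((((γH).1.val : GL (Fin 2) (UnitaryGroup.LocalRing L v)).val.map (Pi.evalRingHom (fun w' : UnitaryGroup.PlacesOver L v => w'.1.adicCompletion L) w))).charpoly).IsRoot x) →
      ∀ δ : ((UnitaryGroup.cmDatum L 3 (Matrix.of fun i j : Fin 3 => if i.val + j.val + 1 = 3 then (1 : L) else 0)).Local v), IsLocalNormPair L (Matrix.of fun i j : Fin 3 => if i.val + j.val + 1 = 3 then (1 : L) else 0) v γH δ →
        ∀ M : Submodule (Valued.integer (w.1.adicCompletion L)) (Fin 3 → w.1.adicCompletion L), IsVertexLattice (galAdicCompletionMap (L := L) (IsCMField.complexConj L) hw) ϖ ((StdForm.antidiagonal 3).over (w.1.adicCompletion L)) 0 M →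
          mapGL ((localNonsplitEquiv (IsCMField.complexConj L) (Matrix.of fun i j : Fin 3 => if i.val + j.val + 1 = 3 then (1 : L) else 0) (IsCMField.complexConj_ne_one L) w hw δ :
              ↥(unitaryGroupOfForm (galAdicCompletionMap (L := L) (IsCMField.complexConj L) hw) (placeForm (Matrix.of fun i j : Fin 3 => if i.val + j.val + 1 = 3 then (1 : L) else 0) w.1))) : GL (Fin 3) (w.1.adicCompletion L)) M = M →
          LatticeNearTransvShell ϖ (d % 2) (mstarOfRecord d) ((((localNonsplitEquiv (IsCMField.complexConj L) (Matrix.of fun i j : Fin 3 => if i.val + j.val + 1 = 3 then (1 : L) else 0) (IsCMField.complexConj_ne_one L) w hw δ :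
              ↥(unitaryGroupOfForm (galAdicCompletionMap (L := L) (IsCMField.complexConj L) hw) (placeForm (Matrix.of fun i j : Fin 3 => if i.val + j.val + 1 = 3 then (1 : L) else 0) w.1))) : GL (Fin 3) (w.1.adicCompletion L)) : Matrix (Fin 3) (Fin 3) (w.1.adicCompletion L)) - 1) M →
          LatticeLabelPlus (galAdicCompletionMap (L := L) (IsCMField.complexConj L) hw) ϖ d (mstarOfRecord d) M ((((localNonsplitEquiv (IsCMField.complexConj L) (Matrix.of fun i j : Fin 3 => if i.val + j.val + 1 = 3 then (1 : L) else 0) (IsCMField.complexConj_ne_one L) w hw δ :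
              ↥(unitaryGroupOfForm (galAdicCompletionMap (L := L) (IsCMField.complexConj L) hw) (placeForm (Matrix.of fun i j : Fin 3 => if i.val + j.val + 1 = 3 then (1 : L) else 0) w.1))) : GL (Fin 3) (w.1.adicCompletion L)) : Matrix (Fin 3) (Fin 3) (w.1.adicCompletion L)) - 1) →
          LatticeInLevel ϖ (mcOfRecord d) (((((localNonsplitEquiv (IsCMField.complexConj L) (Matrix.of fun i j : Fin 3 => if i.val + j.val + 1 = 3 then (1 : L) else 0) (IsCMField.complexConj_ne_one L) w hw δ :
              ↥(unitaryGroupOfForm (galAdicCompletionMap (L := L) (IsCMField.complexConj L) hw) (placeForm (Matrix.of fun i j : Fin 3 => if i.val + j.val + 1 = 3 then (1 : L) else 0) w.1))) : GL (Fin 3) (w.1.adicCompletion L)) : Matrix (Fin 3) (Fin 3) (w.1.adicCompletion L)) - 1) * ((((localNonsplitEquiv (IsCMField.complexConj L) (Matrix.of fun i j : Fin 3 => if i.val + j.val + 1 = 3 then (1 : L) else 0) (IsCMField.complexConj_ne_one L) w hw δ :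
              ↥(unitaryGroupOfForm (galAdicCompletionMap (L := L) (IsCMField.complexConj L) hw) (placeForm (Matrix.of fun i j : Fin 3 => if i.val + j.val + 1 = 3 then (1 : L) else 0) w.1))) : GL (Fin 3) (w.1.adicCompletion L)) : Matrix (Fin 3) (Fin 3) (w.1.adicCompletion L)) - 1)) M)
    (hβT : ∃ V ∈ 𝓝 (1 : ((UnitaryGroup.cmDatum L 2 (Matrix.of fun i j : Fin 2 => if i.val + j.val + 1 = 2 then (1 : L) else 0)).Local v × (UnitaryGroup.cmDatum L 1 (Matrix.of fun i j : Fin 1 => if i.val + j.val + 1 = 1 then (1 : L) else 0)).Local v)), ∀ γH ∈ V, IsLocalGRegular L v γH →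
      ¬ (∃ x : (w.1.adicCompletion L), (((((γH).1.val : GL (Fin 2) (UnitaryGroup.LocalRing L v)).val.map (Pi.evalRingHom (fun w' : UnitaryGroup.PlacesOver L v => w'.1.adicCompletion L) w))).charpoly).IsRoot x) →
      ∀ δp δm : ((UnitaryGroup.cmDatum L 3 (Matrix.of fun i j : Fin 3 => if i.val + j.val + 1 = 3 then (1 : L) else 0)).Local v), IsLocalNormPair L (Matrix.of fun i j : Fin 3 => if i.val + j.val + 1 = 3 then (1 : L) else 0) v γH δp → finKappaAt L v (Matrix.of fun i j : Fin 3 => if i.val + j.val + 1 = 3 then (1 : L) else 0) γH δp = 1 → IsLocalNormPair L (Matrix.of fun i j : Fin 3 => if i.val + j.val + 1 = 3 then (1 : L) else 0) v γH δm → finKappaAt L v (Matrix.of fun i j : Fin 3 => if i.val + j.val + 1 = 3 then (1 : L) else 0) γH δm = -1 →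
        (transvPlusFixCount (galAdicCompletionMap (L := L) (IsCMField.complexConj L) hw) ϖ d (d % 2) (mstarOfRecord d) ((localNonsplitEquiv (IsCMField.complexConj L) (Matrix.of fun i j : Fin 3 => if i.val + j.val + 1 = 3 then (1 : L) else 0) (IsCMField.complexConj_ne_one L) w hw δp :
              ↥(unitaryGroupOfForm (galAdicCompletionMap (L := L) (IsCMField.complexConj L) hw) (placeForm (Matrix.of fun i j : Fin 3 => if i.val + j.val + 1 = 3 then (1 : L) else 0) w.1))) : GL (Fin 3) (w.1.adicCompletion L)) : ℤ) -
            (cleanMinusFixCount (galAdicCompletionMap (L := L) (IsCMField.complexConj L) hw) ϖ d (d % 2) (mstarOfRecord d) (mcOfRecord d) ((localNonsplitEquiv (IsCMField.complexConj L) (Matrix.of fun i j : Fin 3 => if i.val + j.val + 1 = 3 then (1 : L) else 0) (IsCMField.complexConj_ne_one L) w hw δp :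
              ↥(unitaryGroupOfForm (galAdicCompletionMap (L := L) (IsCMField.complexConj L) hw) (placeForm (Matrix.of fun i j : Fin 3 => if i.val + j.val + 1 = 3 then (1 : L) else 0) w.1))) : GL (Fin 3) (w.1.adicCompletion L)) : ℤ) =
          (transvPlusFixCount (galAdicCompletionMap (L := L) (IsCMField.complexConj L) hw) ϖ d (d % 2) (mstarOfRecord d) ((localNonsplitEquiv (IsCMField.complexConj L) (Matrix.of fun i j : Fin 3 => if i.val + j.val + 1 = 3 then (1 : L) else 0) (IsCMField.complexConj_ne_one L) w hw δm :
              ↥(unitaryGroupOfForm (galAdicCompletionMap (L := L) (IsCMField.complexConj L) hw) (placeForm (Matrix.of fun i j : Fin 3 => if i.val + j.val + 1 = 3 then (1 : L) else 0) w.1))) : GL (Fin 3) (w.1.adicCompletion L)) : ℤ) -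
            (cleanMinusFixCount (galAdicCompletionMap (L := L) (IsCMField.complexConj L) hw) ϖ d (d % 2) (mstarOfRecord d) (mcOfRecord d) ((localNonsplitEquiv (IsCMField.complexConj L) (Matrix.of fun i j : Fin 3 => if i.val + j.val + 1 = 3 then (1 : L) else 0) (IsCMField.complexConj_ne_one L) w hw δm :
              ↥(unitaryGroupOfForm (galAdicCompletionMap (L := L) (IsCMField.complexConj L) hw) (placeForm (Matrix.of fun i j : Fin 3 => if i.val + j.val + 1 = 3 then (1 : L) else 0) w.1))) : GL (Fin 3) (w.1.adicCompletion L)) : ℤ)) :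
    ∃ V ∈ 𝓝 (1 : ((UnitaryGroup.cmDatum L 2 (Matrix.of fun i j : Fin 2 => if i.val + j.val + 1 = 2 then (1 : L) else 0)).Local v × (UnitaryGroup.cmDatum L 1 (Matrix.of fun i j : Fin 1 => if i.val + j.val + 1 = 1 then (1 : L) else 0)).Local v)), ∀ γH ∈ V, IsLocalGRegular L v γH →
        ¬ (∃ x : (w.1.adicCompletion L), (((((γH).1.val : GL (Fin 2) (UnitaryGroup.LocalRing L v)).val.map (Pi.evalRingHom (fun w' : UnitaryGroup.PlacesOver L v => w'.1.adicCompletion L) w))).charpoly).IsRoot x) →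
        ∑ᶠ c : ConjClasses ((UnitaryGroup.cmDatum L 3 (Matrix.of fun i j : Fin 3 => if i.val + j.val + 1 = 3 then (1 : L) else 0)).Local v), ((finExplicitCollection L (Matrix.of fun i j : Fin 3 => if i.val + j.val + 1 = 3 then (1 : L) else 0) μ (finExplicitDelta_conj_left_all L (Matrix.of fun i j : Fin 3 => if i.val + j.val + 1 = 3 then (1 : L) else 0) μ) (finExplicitDelta_conj_right_all L (Matrix.of fun i j : Fin 3 => if i.val + j.val + 1 = 3 then (1 : L) else 0) μ)) v).Δ γH (Quotient.out c) * classOrbitalIntegral mG₃ ((gselStar 1) L v w hw ϖ) c =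
          ((1/2 : ℚ) : ℂ) * (∑ᶠ c : ConjClasses ((UnitaryGroup.cmDatum L 3 (Matrix.of fun i j : Fin 3 => if i.val + j.val + 1 = 3 then (1 : L) else 0)).Local v), ((finExplicitCollection L (Matrix.of fun i j : Fin 3 => if i.val + j.val + 1 = 3 then (1 : L) else 0) μ (finExplicitDelta_conj_left_all L (Matrix.of fun i j : Fin 3 => if i.val + j.val + 1 = 3 then (1 : L) else 0) μ) (finExplicitDelta_conj_right_all L (Matrix.of fun i j : Fin 3 => if i.val + j.val + 1 = 3 then (1 : L) else 0) μ)) v).Δ γH (Quotient.out c) * classOrbitalIntegral mG₃ (Set.indicator {u : ((UnitaryGroup.cmDatum L 3 (Matrix.of fun i j : Fin 3 => if i.val + j.val + 1 = 3 then (1 : L) else 0)).Local v) | u ∈ cmLocalIntegralLevel L 3 (Matrix.of fun i j : Fin 3 => if i.val + j.val + 1 = 3 then (1 : L) else 0) v ∧ (InLevel ϖ (laLowOfRecord d) (wMatrix L w hw u - 1) ∧ InLevel ϖ (mcOfRecord d) ((wMatrix L w hw u - 1) * (wMatrix L w hw u - 1)))} (fun _ => (1 : ℂ))) c) +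
          ((-1/2 : ℚ) : ℂ) * (∑ᶠ c : ConjClasses ((UnitaryGroup.cmDatum L 3 (Matrix.of fun i j : Fin 3 => if i.val + j.val + 1 = 3 then (1 : L) else 0)).Local v), ((finExplicitCollection L (Matrix.of fun i j : Fin 3 => if i.val + j.val + 1 = 3 then (1 : L) else 0) μ (finExplicitDelta_conj_left_all L (Matrix.of fun i j : Fin 3 => if i.val + j.val + 1 = 3 then (1 : L) else 0) μ) (finExplicitDelta_conj_right_all L (Matrix.of fun i j : Fin 3 => if i.val + j.val + 1 = 3 then (1 : L) else 0) μ)) v).Δ γH (Quotient.out c) * classOrbitalIntegral mG₃ (Set.indicator {u : ((UnitaryGroup.cmDatum L 3 (Matrix.of fun i j : Fin 3 => if i.val + j.val + 1 = 3 then (1 : L) else 0)).Local v) | u ∈ cmLocalIntegralLevel L 3 (Matrix.of fun i j : Fin 3 => if i.val + j.val + 1 = 3 then (1 : L) else 0) v ∧ (InLevel ϖ (laHighOfRecord d) (wMatrix L w hw u - 1) ∧ InLevel ϖ (mcOfRecord d) ((wMatrix L w hw u - 1) * (wMatrix L w hw u - 1)))} (fun _ => (1 : ℂ))) c) := by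
  have hH : ((Matrix.of fun i j : Fin 3 => if i.val + j.val + 1 = 3 then (1 : L) else 0).map (cmConjRingHom L))ᵀ = (Matrix.of fun i j : Fin 3 => if i.val + j.val + 1 = 3 then (1 : L) else 0) := antidiagOne_isHermitian L 3
  have hdet : (Matrix.of fun i j : Fin 3 => if i.val + j.val + 1 = 3 then (1 : L) else 0).det ≠ 0 := (isUnit_antidiagOne_det L 3).ne_zero
  have hH'u : IsUnit (Matrix.of fun i j : Fin 3 => if i.val + j.val + 1 = 3 then (1 : L) else 0) := (Matrix.isUnit_iff_isUnit_det _).2 (isUnit_antidiagOne_det L 3)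
  have hϖ1 : Valued.v ϖ ≤ 1 := (uniformizer_facts L w hϖ).2.1.le
  have hd1 : 1 ≤ d := hD.2.2.2.2.2.1
  have hmc : mstarOfRecord d ≤ mcOfRecord d := by
    show d % 2 + 2 * d - 1 ≤ 2 * ((d % 2 + 2 * d - 1 + d) / 2)
    omega
  have hdp : dOfPlace L v w = d := dOfPlace_eq_of_isRamifiedQuadraticDatum L w hw he hD
  have hms : mstarFn L v w = mstarOfRecord d := by rw [mstarFn, hdp]
  obtain ⟨Vα, hVα, hα⟩ := hαT
  obtain ⟨Vβ, hVβ, hβ⟩ := hβT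
  refine ⟨Vα ∩ Vβ, Filter.inter_mem hVα hVβ, fun γH hγ hreg hirr => ?_⟩
  obtain ⟨hγα, hγβ⟩ := hγ
  -- one match exists (frame `T = 1`), hence the signed pair serving every test function (★ p847309)
  obtain ⟨b₀, hb₀⟩ := exists_isLocalNormPair_of_formCongr L (Matrix.of fun i j : Fin 3 => if i.val + j.val + 1 = 3 then (1 : L) else 0) w hw (1 : GL (Fin 3) (w.1.adicCompletion L)) (c := (1 : w.1.adicCompletion L)) isUnit_one
    (by rw [one_smul, placeForm_antidiagThree_eq_over L w, formCongr_one_eq]) γH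
  obtain ⟨δp, δm, hp, hκp, hm, hκm, -, -, hsum⟩ :=
    exists_signedPair_finsum_delta_mul_classOrbitalIntegral_eq_mul_sub L (Matrix.of fun i j : Fin 3 => if i.val + j.val + 1 = 3 then (1 : L) else 0) hH hdet w hw μ
      (finExplicitDelta_conj_left_all L (Matrix.of fun i j : Fin 3 => if i.val + j.val + 1 = 3 then (1 : L) else 0) μ) (finExplicitDelta_conj_right_all L (Matrix.of fun i j : Fin 3 => if i.val + j.val + 1 = 3 then (1 : L) else 0) μ) hirr hb₀
  rw [hsum mG₃ ((gselStar 1) L v w hw ϖ),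
    hsum mG₃ (Set.indicator {u : ((UnitaryGroup.cmDatum L 3 (Matrix.of fun i j : Fin 3 => if i.val + j.val + 1 = 3 then (1 : L) else 0)).Local v) | u ∈ cmLocalIntegralLevel L 3 (Matrix.of fun i j : Fin 3 => if i.val + j.val + 1 = 3 then (1 : L) else 0) v ∧ (InLevel ϖ (laLowOfRecord d) (wMatrix L w hw u - 1) ∧ InLevel ϖ (mcOfRecord d) ((wMatrix L w hw u - 1) * (wMatrix L w hw u - 1)))} (fun _ => (1 : ℂ))),
    hsum mG₃ (Set.indicator {u : ((UnitaryGroup.cmDatum L 3 (Matrix.of fun i j : Fin 3 => if i.val + j.val + 1 = 3 then (1 : L) else 0)).Local v) | u ∈ cmLocalIntegralLevel L 3 (Matrix.of fun i j : Fin 3 => if i.val + j.val + 1 = 3 then (1 : L) else 0) v ∧ (InLevel ϖ (laHighOfRecord d) (wMatrix L w hw u - 1) ∧ InLevel ϖ (mcOfRecord d) ((wMatrix L w hw u - 1) * (wMatrix L w hw u - 1)))} (fun _ => (1 : ℂ)))]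
  -- the census reading at `δ₊`, `δ₋`: regular (★), compact centraliser (★ p846839)
  haveI := compactSpace_centralizer_of_isLocalNormPair_of_not_exists_isRoot_nonsplit L v w hw hH'u hreg hirr δp hp
  haveI := compactSpace_centralizer_of_isLocalNormPair_of_not_exists_isRoot_nonsplit L v w hw hH'u hreg hirr δm hm
  have hregp : IsRegularElt (δp.val : GL (Fin 3) (UnitaryGroup.LocalRing L v)) := isRegularElt_of_isLocalNormPair L (Matrix.of fun i j : Fin 3 => if i.val + j.val + 1 = 3 then (1 : L) else 0) v hp hreg
  have hregm : IsRegularElt (δm.val : GL (Fin 3) (UnitaryGroup.LocalRing L v)) := isRegularElt_of_isLocalNormPair L (Matrix.of fun i j : Fin 3 => if i.val + j.val + 1 = 3 then (1 : L) else 0) v hm hreg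
  rw [show (gselStar 1) L v w hw ϖ = pieceTransvPlus L v w hw ϖ from rfl,
    classOrbitalIntegral_transvPlus_eq_mul_ncard_of_isRegularElt L w hw he ϖ hϖ νG₃ mG₃ hmG δp hregp,
    classOrbitalIntegral_transvPlus_eq_mul_ncard_of_isRegularElt L w hw he ϖ hϖ νG₃ mG₃ hmG δm hregm,
    classOrbitalIntegral_levels_eq_mul_ncard_of_isRegularElt L w hw he ϖ hϖ νG₃ mG₃ hmG (laLowOfRecord d) (mcOfRecord d) δp hregp,
    classOrbitalIntegral_levels_eq_mul_ncard_of_isRegularElt L w hw he ϖ hϖ νG₃ mG₃ hmG (laLowOfRecord d) (mcOfRecord d) δm hregm,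
    classOrbitalIntegral_levels_eq_mul_ncard_of_isRegularElt L w hw he ϖ hϖ νG₃ mG₃ hmG (laHighOfRecord d) (mcOfRecord d) δp hregp,
    classOrbitalIntegral_levels_eq_mul_ncard_of_isRegularElt L w hw he ϖ hϖ νG₃ mG₃ hmG (laHighOfRecord d) (mcOfRecord d) δm hregm,
    hms, hdp]
  -- the lattice identity at the two literals
  have key := two_mul_sub_transvPlusFixCount_eq_of_cleanSgn_eq (galAdicCompletionMap (L := L) (IsCMField.complexConj L) hw) hϖ1 d (d % 2) hmc
    ((localNonsplitEquiv (IsCMField.complexConj L) (Matrix.of fun i j : Fin 3 => if i.val + j.val + 1 = 3 then (1 : L) else 0) (IsCMField.complexConj_ne_one L) w hw δp :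
              ↥(unitaryGroupOfForm (galAdicCompletionMap (L := L) (IsCMField.complexConj L) hw) (placeForm (Matrix.of fun i j : Fin 3 => if i.val + j.val + 1 = 3 then (1 : L) else 0) w.1))) : GL (Fin 3) (w.1.adicCompletion L))
    ((localNonsplitEquiv (IsCMField.complexConj L) (Matrix.of fun i j : Fin 3 => if i.val + j.val + 1 = 3 then (1 : L) else 0) (IsCMField.complexConj_ne_one L) w hw δm :
              ↥(unitaryGroupOfForm (galAdicCompletionMap (L := L) (IsCMField.complexConj L) hw) (placeForm (Matrix.of fun i j : Fin 3 => if i.val + j.val + 1 = 3 then (1 : L) else 0) w.1))) : GL (Fin 3) (w.1.adicCompletion L))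
    (finite_fixed_typeZero_of_isRegularElt L w hw he ϖ hϖ δp hregp) (finite_fixed_typeZero_of_isRegularElt L w hw he ϖ hϖ δm hregm)
    (hα γH hγα hreg hirr δp hp) (hα γH hγα hreg hirr δm hm) (hβ γH hγβ hreg hirr δp δm hp hκp hm hκm)
  simp only [levFixCount, laLowOfRecord, laHighOfRecord] at key ⊢
  have key' := congrArg (Int.cast : ℤ → ℂ) key
  push_cast at key'
  linear_combination (finTau L v γH μ * (finWeylRatio L v γH : ℂ) * (((νG₃ ((cmLocalIntegralLevel L 3 (Matrix.of fun i j : Fin 3 => if i.val + j.val + 1 = 3 then (1 : L) else 0) v) : Set ((UnitaryGroup.cmDatum L 3 (Matrix.of fun i j : Fin 3 => if i.val + j.val + 1 = 3 then (1 : L) else 0)).Local v))).toReal : ℂ)) / 2) * key'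

end Summit.HodgeConjecture.HodgeConjecture.Cruxes.H413.F0P3cDyRamTransvPlusTypeTwoOfCleanLevels

end
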